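import Summits.BirchSwinnertonDyer.Rank2.CertifiedPartnerTypeBModel
import Literature.NumberTheory.EllipticCurves.IsogenyTwoTorsionProofs
import Literature.NumberTheory.EllipticCurves.IsogenyVariableChangeProofs
import Literature.NumberTheory.EllipticCurves.IsogenyCompProofs
import HarnessLib

/-!
# Certified partners of Greenberg type B, I″: the full-`2`-torsion neighbour `W″_k = W′_k/⟨(0,0)⟩` (cell `bsd-rank2`)

Cell `bsd-rank2` (D-0036), seat `bsd-rank2-lit` GEN 18, for the E1 line `cfsplit` of route
`EisensteinDepletionAtTwo` (crux `DepletedLambdaLawAtTwoMod`, planner p2 GEN 16), stub `stub_partnerCF`: its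
«`W″` block» asks, next to the type-B partner `W′`, for a curve `W″` ℚ-ISOGENOUS to `W′`, globally minimal, good
ordinary at `2`, with FULL rational `2`-torsion and a Greenberg Prop-5.14 point (the «CF habitat» of cell
`bsd-2adic`). For the family `W′_k = ⟨1, −12k−7, 0, (6k+3)², 0⟩` of `Rank2/CertifiedPartnerTypeBModel.lean` this
file exhibits `W″_k = ⟨1, 24k+11, 0, −(18k+9), 0⟩ : y² + xy = x³ + (24k+11)x² − (18k+9)x` and PROVES:

* `Δ(W″_k) = 729·(2k+1)²·(32k+17)²`, `c₄(W″_k) = 9·(1024k² + 1056k + 273)`; no prime `q` has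
  `q¹² ∣ Δ ∧ q⁴ ∣ c₄` (Bezout: `(1024k²+1056k+273) − (2k+1)(512k+272) = 1`,
  `(1024k²+1056k+273) − (32k+17)(32k+16) = 1`, `9 ∤ 1024k²+1056k+273`): GLOBAL MINIMAL MODEL
  (`isGloballyMinimal_neighbourB`), elliptic (`isElliptic_neighbourB`), GOOD ORDINARY at `2`
  (`isOrdinaryAt_two_neighbourB`: `Δ` odd, reduction `y² + xy = x³ + x² + x` over `𝔽₂`);
* **`IsIsogenous W″_k W′_k`** (`isIsogenous_neighbourB_partnerB`): `W″_k ≅ E₁ : y² = x³ + (96k+54)x² + 9(32k+17)x =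
  x(x+3)(x+96k+51)` by `(u,r,s,t) = (2,−3,1,0)`; Silverman's III.4.5 `2`-isogeny `E₁ → E₂ : Y² = X³ − (192k+108)X² +
  (48(2k+1))²X` (tree theorem `isIsogenous_twoIsogenyCodomain`); `E₂ ≅ W′_k` by `(u,r,s,t) = (4,0,2,0)`. So `W′_k =
  W″_k/⟨(3/4, −3/8)⟩` and dually `W″_k = W′_k/⟨(0,0)⟩`.

The `2`-torsion and Prop-5.14 bookkeeping of `W″_k` is in `Rank2/CertifiedPartnerTypeB.lean`.

PARTITION: none — r_an ≥ 2, summit axis S0; TWIN (D-0056): n/a. B1: explicit-model algebra; no `L`-function, no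
Selmer group, no S0 motion. No named fact, no `sorry`. Templates: `Rank2/Family81517MinimalOrdinary.lean`,
`Rank2/Family81517ReferenceIsogeny.lean`.
-/

noncomputable section

namespace Summit.BirchSwinnertonDyer.Rank2

open _root_.WeierstrassCurve
open Literature.NumberTheory.EllipticCurves
open Literature.NumberTheory.EllipticCurves.Rank1Residual.X11RankOneCertificates

section NeighbourTypeBModel

/-! ### The integer model `W″_k`, its discriminant and `c₄` -/

/-- `Δ(⟨1, 24k+11, 0, −(18k+9), 0⟩) = 729(2k+1)²(32k+17)²`. [folklore] -/
theorem neighbourBInt_Δ (k : ℤ) :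
    (⟨1, 24 * k + 11, 0, -(18 * k + 9), 0⟩ : WeierstrassCurve ℤ).Δ =
      729 * (2 * k + 1) ^ 2 * (32 * k + 17) ^ 2 := by
  simp only [WeierstrassCurve.Δ, WeierstrassCurve.b₂, WeierstrassCurve.b₄, WeierstrassCurve.b₆,
    WeierstrassCurve.b₈]
  ring

/-- `c₄(⟨1, 24k+11, 0, −(18k+9), 0⟩) = 9(1024k² + 1056k + 273)` (certificate schema's `c4Of`). [folklore] -/
theorem c4Of_neighbourB (k : ℤ) :
    c4Of [1, 24 * k + 11, 0, -(18 * k + 9), 0] = 9 * (1024 * k ^ 2 + 1056 * k + 273) := by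
  simp only [c4Of, invariants]
  ring

/-- The certificate schema's `discOf` of `[1, A, 0, b, 0]`-shaped lists, for the neighbour. [folklore] -/
theorem discOf_neighbourB (k : ℤ) :
    discOf [1, 24 * k + 11, 0, -(18 * k + 9), 0] = 729 * (2 * k + 1) ^ 2 * (32 * k + 17) ^ 2 := by
  rw [discOf_family81517, neighbourBInt_Δ]

/-- The rational model with all coefficients as integer casts. [folklore] -/
theorem neighbourB_model_eq_intCast (k : ℤ) :
    (⟨1, ((24 * k + 11 : ℤ) : ℚ), 0, ((-(18 * k + 9) : ℤ) : ℚ), 0⟩ : WeierstrassCurve ℚ) =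
      ⟨((1 : ℤ) : ℚ), ((24 * k + 11 : ℤ) : ℚ), ((0 : ℤ) : ℚ), ((-(18 * k + 9) : ℤ) : ℚ), ((0 : ℤ) : ℚ)⟩ := by
  ext <;> simp

/-- The rational model is the base change of the integer model. [folklore] -/
theorem neighbourBInt_baseChange (k : ℤ) :
    (⟨1, 24 * k + 11, 0, -(18 * k + 9), 0⟩ : WeierstrassCurve ℤ).baseChange ℚ =
      ⟨1, ((24 * k + 11 : ℤ) : ℚ), 0, ((-(18 * k + 9) : ℤ) : ℚ), 0⟩ := by
  rw [baseChange_int_eq_map]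
  ext <;> simp [WeierstrassCurve.map]

/-- The discriminant of the rational model. [folklore] -/
theorem neighbourB_Δ (k : ℤ) :
    (⟨1, ((24 * k + 11 : ℤ) : ℚ), 0, ((-(18 * k + 9) : ℤ) : ℚ), 0⟩ : WeierstrassCurve ℚ).Δ =
      729 * (2 * k + 1) ^ 2 * (32 * k + 17) ^ 2 := by
  simp only [WeierstrassCurve.Δ, WeierstrassCurve.b₂, WeierstrassCurve.b₄, WeierstrassCurve.b₆,
    WeierstrassCurve.b₈]
  push_cast
  ring

/-- `Δ(W″_k)` is odd. [folklore] -/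
theorem odd_Δ_neighbourB (k : ℤ) : Odd (729 * (2 * k + 1) ^ 2 * (32 * k + 17) ^ 2 : ℤ) := by
  have h729 : Odd (729 : ℤ) := by decide
  have h1 : Odd (2 * k + 1 : ℤ) := ⟨k, by ring⟩
  have h17 : Odd (32 * k + 17 : ℤ) := ⟨16 * k + 8, by ring⟩
  exact (h729.mul h1.pow).mul h17.pow

/-- `Δ(W″_k) ≠ 0`. [folklore] -/
theorem Δ_neighbourB_ne_zero (k : ℤ) : (729 * (2 * k + 1) ^ 2 * (32 * k + 17) ^ 2 : ℤ) ≠ 0 := by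
  intro h
  have := Int.odd_iff.mp (odd_Δ_neighbourB k)
  rw [h] at this
  norm_num at this

/-! ### Silverman's criterion for `W″_k` -/

/-- `9 ∤ 1024k² + 1056k + 273`. [folklore] -/
theorem not_nine_dvd_neighbourB_c₄ (k : ℤ) : ¬ (9 : ℤ) ∣ 1024 * k ^ 2 + 1056 * k + 273 := by
  intro h9
  have h3 : (3 : ℤ) ∣ 1024 * k ^ 2 + 1056 * k + 273 := dvd_trans ⟨3, by norm_num⟩ h9
  have hk2 : (3 : ℤ) ∣ k ^ 2 := by
    have hsplit : (1024 * k ^ 2 + 1056 * k + 273 : ℤ) = 3 * (341 * k ^ 2 + 352 * k + 91) + k ^ 2 := by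
      ring
    rw [hsplit] at h3
    exact (dvd_add_right (Dvd.intro _ rfl)).mp h3
  obtain ⟨j, rfl⟩ := Int.prime_three.dvd_of_dvd_pow hk2
  have hsplit : (1024 * (3 * j) ^ 2 + 1056 * (3 * j) + 273 : ℤ) =
      9 * (1024 * j ^ 2 + 352 * j + 30) + 3 := by
    ring
  rw [hsplit] at h9
  have h6 : (9 : ℤ) ∣ 3 := (dvd_add_right (Dvd.intro _ rfl)).mp h9
  omega

/-- **No prime `q` has `q¹² ∣ Δ(W″_k)` and `q⁴ ∣ c₄(W″_k)`** (Bezout certificates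
`(1024k²+1056k+273) − (2k+1)(512k+272) = 1`, `(1024k²+1056k+273) − (32k+17)(32k+16) = 1`). [folklore] -/
theorem not_pow_dvd_Δ_and_c₄_neighbourB (k : ℤ) (q : ℕ) (hq : q.Prime) :
    ¬ ((q : ℤ) ^ 12 ∣ 729 * (2 * k + 1) ^ 2 * (32 * k + 17) ^ 2 ∧
        (q : ℤ) ^ 4 ∣ 9 * (1024 * k ^ 2 + 1056 * k + 273)) := by
  rintro ⟨h12, h4⟩
  have hqp : Prime (q : ℤ) := Nat.prime_iff_prime_int.mp hq
  have hq1 : (q : ℤ) ∣ 729 * (2 * k + 1) ^ 2 * (32 * k + 17) ^ 2 :=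
    dvd_trans (dvd_pow_self (q : ℤ) (by norm_num)) h12
  have hq2 : (q : ℤ) ∣ 9 * (1024 * k ^ 2 + 1056 * k + 273) :=
    dvd_trans (dvd_pow_self (q : ℤ) (by norm_num)) h4
  by_cases hq3 : q = 3
  · subst hq3
    obtain ⟨c, hc⟩ := h4
    push_cast at hc
    have h9 : (9 : ℤ) ∣ 1024 * k ^ 2 + 1056 * k + 273 := ⟨c, by linarith⟩
    exact not_nine_dvd_neighbourB_c₄ k h9
  · have hq3Z : ¬ (q : ℤ) ∣ 3 := by
      intro h
      have hq3' : q ∣ 3 := by exact_mod_cast h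
      rcases (Nat.dvd_prime Nat.prime_three).mp hq3' with h1 | h1
      · exact hq.one_lt.ne' h1
      · exact hq3 h1
    have hq9 : ¬ (q : ℤ) ∣ 9 := fun h ↦ hq3Z (hqp.dvd_of_dvd_pow (by norm_num; exact h : (q : ℤ) ∣ 3 ^ 2))
    have hq729 : ¬ (q : ℤ) ∣ 729 := fun h ↦
      hq3Z (hqp.dvd_of_dvd_pow (by norm_num; exact h : (q : ℤ) ∣ 3 ^ 6))
    have hf : (q : ℤ) ∣ 1024 * k ^ 2 + 1056 * k + 273 := (hqp.dvd_or_dvd hq2).resolve_left hq9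
    have hΔ : (q : ℤ) ∣ (2 * k + 1) ^ 2 * (32 * k + 17) ^ 2 := by
      rw [mul_assoc] at hq1
      exact (hqp.dvd_or_dvd hq1).resolve_left hq729
    rcases hqp.dvd_or_dvd hΔ with h21 | h17
    · have h21' : (q : ℤ) ∣ 2 * k + 1 := hqp.dvd_of_dvd_pow h21
      have h1 : (q : ℤ) ∣ (1024 * k ^ 2 + 1056 * k + 273) - (2 * k + 1) * (512 * k + 272) :=
        dvd_sub hf (dvd_mul_of_dvd_left h21' _)
      have hone : ((1024 * k ^ 2 + 1056 * k + 273) - (2 * k + 1) * (512 * k + 272) : ℤ) = 1 := by ring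
      rw [hone] at h1
      exact hq.not_dvd_one (by exact_mod_cast h1)
    · have h17' : (q : ℤ) ∣ 32 * k + 17 := hqp.dvd_of_dvd_pow h17
      have h1 : (q : ℤ) ∣ (1024 * k ^ 2 + 1056 * k + 273) - (32 * k + 17) * (32 * k + 16) :=
        dvd_sub hf (dvd_mul_of_dvd_left h17' _)
      have hone : ((1024 * k ^ 2 + 1056 * k + 273) - (32 * k + 17) * (32 * k + 16) : ℤ) = 1 := by ring
      rw [hone] at h1
      exact hq.not_dvd_one (by exact_mod_cast h1)

/-! ### Global minimality, integral model, minimal discriminant, ellipticity of `W″_k` -/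

/-- **`W″_k = ⟨1, 24k+11, 0, −(18k+9), 0⟩` is a global minimal model.**
[folklore: Silverman AEC VII.1 Remark 1.1, VIII.8] -/
theorem isGloballyMinimal_neighbourB (k : ℤ) :
    (⟨1, ((24 * k + 11 : ℤ) : ℚ), 0, ((-(18 * k + 9) : ℤ) : ℚ), 0⟩ :
      WeierstrassCurve ℚ).IsGloballyMinimal := by
  rw [neighbourB_model_eq_intCast]
  refine isGloballyMinimal_of_int_criterion _ _ _ _ _ fun q hq hboth => ?_
  obtain ⟨h12, h4⟩ := hboth
  rw [discOf_neighbourB] at h12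
  rw [c4Of_neighbourB] at h4
  exact not_pow_dvd_Δ_and_c₄_neighbourB k q hq ⟨h12, h4⟩

/-- The tree's integral model of `W″_k` is `⟨1, 24k+11, 0, −(18k+9), 0⟩` itself. [folklore] -/
theorem integralModelInt_neighbourB (k : ℤ) :
    haveI := isGloballyMinimal_neighbourB k
    integralModelInt (⟨1, ((24 * k + 11 : ℤ) : ℚ), 0, ((-(18 * k + 9) : ℤ) : ℚ), 0⟩ :
      WeierstrassCurve ℚ) = ⟨1, 24 * k + 11, 0, -(18 * k + 9), 0⟩ := by
  haveI := isGloballyMinimal_neighbourB k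
  have key : ∀ (X : WeierstrassCurve ℚ) [X.IsGloballyMinimal],
      (⟨1, 24 * k + 11, 0, -(18 * k + 9), 0⟩ : WeierstrassCurve ℤ).baseChange ℚ = X →
        integralModelInt X = ⟨1, 24 * k + 11, 0, -(18 * k + 9), 0⟩ := by
    rintro X _ rfl
    exact integralModelInt_baseChange_int _
  exact key _ (neighbourBInt_baseChange k)

/-- The minimal discriminant of `W″_k` is `729(2k+1)²(32k+17)²`. [folklore] -/
theorem minimalDiscriminantInt_neighbourB (k : ℤ) :
    haveI := isGloballyMinimal_neighbourB k
    minimalDiscriminantInt (⟨1, ((24 * k + 11 : ℤ) : ℚ), 0, ((-(18 * k + 9) : ℤ) : ℚ), 0⟩ :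
      WeierstrassCurve ℚ) = 729 * (2 * k + 1) ^ 2 * (32 * k + 17) ^ 2 := by
  rw [minimalDiscriminantInt, integralModelInt_neighbourB, neighbourBInt_Δ]

/-- `W″_k` is an elliptic curve. [folklore] -/
theorem isElliptic_neighbourB (k : ℤ) :
    (⟨1, ((24 * k + 11 : ℤ) : ℚ), 0, ((-(18 * k + 9) : ℤ) : ℚ), 0⟩ :
      WeierstrassCurve ℚ).IsElliptic := by
  refine ⟨isUnit_iff_ne_zero.mpr ?_⟩
  rw [neighbourB_Δ]
  exact_mod_cast Δ_neighbourB_ne_zero k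

/-! ### Good ordinary reduction at `2` of `W″_k` -/

/-- **Good reduction at `2`** (`Δ` odd). [folklore: Silverman AEC VII.1 Remark 1.1] -/
theorem hasGoodReductionAtPrime_two_neighbourB (k : ℤ) :
    haveI := isGloballyMinimal_neighbourB k
    (⟨1, ((24 * k + 11 : ℤ) : ℚ), 0, ((-(18 * k + 9) : ℤ) : ℚ), 0⟩ :
      WeierstrassCurve ℚ).HasGoodReductionAtPrime 2 := by
  haveI := isGloballyMinimal_neighbourB k
  refine hasGoodReductionAtPrime_of_not_dvd _ 2 ?_
  rw [minimalDiscriminantInt_neighbourB]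
  exact_mod_cast Int.two_dvd_ne_zero.mpr (Int.odd_iff.mp (odd_Δ_neighbourB k))

/-- The reduction of the integral model of `W″_k` modulo `2` is `⟨1, 1, 0, 1, 0⟩`. [folklore] -/
theorem neighbourBInt_map_zmod_two (k : ℤ) :
    (⟨1, 24 * k + 11, 0, -(18 * k + 9), 0⟩ : WeierstrassCurve ℤ).map (Int.castRingHom (ZMod 2)) =
      ⟨1, 1, 0, 1, 0⟩ := by
  have h2 : ((2 : ℤ) : ZMod 2) = 0 := by decide
  have ha₂ : ((24 * k + 11 : ℤ) : ZMod 2) = 1 := by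
    rw [show (24 * k + 11 : ℤ) = 2 * (12 * k + 5) + 1 by ring, Int.cast_add, Int.cast_mul, h2, zero_mul,
      zero_add, Int.cast_one]
  have ha₄ : ((-(18 * k + 9) : ℤ) : ZMod 2) = 1 := by
    rw [show (-(18 * k + 9) : ℤ) = 2 * (-9 * k - 5) + 1 by ring, Int.cast_add, Int.cast_mul, h2, zero_mul,
      zero_add, Int.cast_one]
  ext
  · show (Int.castRingHom (ZMod 2)) 1 = 1
    rw [map_one]
  · show (Int.castRingHom (ZMod 2)) (24 * k + 11) = 1
    rw [eq_intCast, ha₂]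
  · show (Int.castRingHom (ZMod 2)) 0 = 0
    rw [map_zero]
  · show (Int.castRingHom (ZMod 2)) (-(18 * k + 9)) = 1
    rw [eq_intCast, ha₄]
  · show (Int.castRingHom (ZMod 2)) 0 = 0
    rw [map_zero]

/-- **Ordinary at `2`**: `a₂(W″_k) = 3 − #W̃″(𝔽₂) ∈ {1, −1}` is odd. [folklore] -/
theorem not_two_dvd_frobeniusTrace_neighbourB (k : ℤ) :
    haveI := isGloballyMinimal_neighbourB k
    ¬ ((2 : ℕ) : ℤ) ∣ frobeniusTrace (⟨1, ((24 * k + 11 : ℤ) : ℚ), 0, ((-(18 * k + 9) : ℤ) : ℚ), 0⟩ :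
      WeierstrassCurve ℚ) 2 := by
  haveI := isGloballyMinimal_neighbourB k
  rw [frobeniusTrace, reductionPointCount, integralModelInt_neighbourB, neighbourBInt_map_zmod_two]
  rcases natCard_point_F2_family81517 (1 : ZMod 2) with h | h <;> rw [h] <;> norm_num

/-- **`W″_k` is good ordinary at `2`** (for the minimality instance above). [folklore] -/
theorem isOrdinaryAt_two_neighbourB (k : ℤ) :
    @IsOrdinaryAt (⟨1, ((24 * k + 11 : ℤ) : ℚ), 0, ((-(18 * k + 9) : ℤ) : ℚ), 0⟩ : WeierstrassCurve ℚ)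
      (isGloballyMinimal_neighbourB k) 2 _ :=
  ⟨hasGoodReductionAtPrime_two_neighbourB k, not_two_dvd_frobeniusTrace_neighbourB k⟩

/-! ### `W″_k ~ W′_k`: the explicit `2`-isogeny through Silverman III.4.5 -/

/-- **`W″_k` in two-torsion normal form at `(3/4, −3/8)`**: the change of variables `(u, r, s, t) = (2, −3, 1, 0)`
carries `E₁ : y² = x³ + (96k+54)x² + 9(32k+17)x = x(x+3)(x+96k+51)` to `W″_k`. [cite: SilvermanAEC2009, III.1 (Table 3.1)] -/
theorem smul_twoTorsionNF_eq_neighbourB (k : ℤ) :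
    (⟨Units.mk0 (2 : ℚ) two_ne_zero, -3, 1, 0⟩ : VariableChange ℚ) •
        (⟨0, (96 * k + 54 : ℚ), 0, (288 * k + 153 : ℚ), 0⟩ : WeierstrassCurve ℚ) =
      ⟨1, ((24 * k + 11 : ℤ) : ℚ), 0, ((-(18 * k + 9) : ℤ) : ℚ), 0⟩ := by
  simp only [variableChange_def]
  ext <;> push_cast <;> norm_num <;> ring

/-- **The III.4.5 codomain of `E₁`** is `E₂ : Y² = X³ − (192k+108)X² + 2304(2k+1)²X`
(`(96k+54)² − 36(32k+17) = (48(2k+1))²`). [cite: SilvermanAEC2009, III.4 Example 4.5] -/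
theorem twoIsogenyCodomain_twoTorsionNF_neighbourB (k : ℤ) :
    (⟨0, (96 * k + 54 : ℚ), 0, (288 * k + 153 : ℚ), 0⟩ : WeierstrassCurve ℚ).twoIsogenyCodomain =
      ⟨0, (-(192 * k + 108) : ℚ), 0, (2304 * (2 * k + 1) ^ 2 : ℚ), 0⟩ := by
  simp only [twoIsogenyCodomain]
  ext <;> push_cast <;> ring

/-- **`W′_k` from the codomain**: the change of variables `(u, r, s, t) = (4, 0, 2, 0)` carries `E₂` to
`W′_k = ⟨1, −12k−7, 0, (6k+3)², 0⟩`. [cite: SilvermanAEC2009, III.1 (Table 3.1)] -/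
theorem smul_twoIsogenyCodomain_eq_partnerB (k : ℤ) :
    (⟨Units.mk0 (4 : ℚ) four_ne_zero, 0, 2, 0⟩ : VariableChange ℚ) •
        (⟨0, (-(192 * k + 108) : ℚ), 0, (2304 * (2 * k + 1) ^ 2 : ℚ), 0⟩ : WeierstrassCurve ℚ) =
      ⟨1, ((-12 * k - 7 : ℤ) : ℚ), 0, (((6 * k + 3) ^ 2 : ℤ) : ℚ), 0⟩ := by
  simp only [variableChange_def]
  ext <;> push_cast <;> norm_num <;> ring

/-- The two-torsion normal form `E₁` is elliptic (`Δ = 2¹²·729·(2k+1)²(32k+17)² ≠ 0`).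
[cite: SilvermanAEC2009, III.4 Example 4.5 (b(a² − 4b) ≠ 0)] -/
theorem twoTorsionNF_neighbourB_isElliptic (k : ℤ) :
    (⟨0, (96 * k + 54 : ℚ), 0, (288 * k + 153 : ℚ), 0⟩ : WeierstrassCurve ℚ).IsElliptic := by
  refine ⟨isUnit_iff_ne_zero.mpr ?_⟩
  have hΔ : (⟨0, (96 * k + 54 : ℚ), 0, (288 * k + 153 : ℚ), 0⟩ : WeierstrassCurve ℚ).Δ =
      ((4096 * (729 * (2 * k + 1) ^ 2 * (32 * k + 17) ^ 2) : ℤ) : ℚ) := by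
    simp only [WeierstrassCurve.Δ, WeierstrassCurve.b₂, WeierstrassCurve.b₄, WeierstrassCurve.b₆,
      WeierstrassCurve.b₈]
    push_cast
    ring
  rw [hΔ]
  exact_mod_cast mul_ne_zero (by norm_num) (Δ_neighbourB_ne_zero k)

/-- **`W″_k` is isogenous over `ℚ` to `W′_k`**: `W″_k ≅ E₁`, `E₁ → E₂` Silverman's explicit `2`-isogeny with
kernel `⟨(0,0)⟩` (the image of `(3/4, −3/8) ∈ W″_k`), `E₂ ≅ W′_k`; so `W′_k = W″_k/⟨(3/4, −3/8)⟩` and dually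
`W″_k = W′_k/⟨(0,0)⟩`. [cite: SilvermanAEC2009, III.4 Example 4.5] -/
theorem isIsogenous_neighbourB_partnerB (k : ℤ) :
    IsIsogenous (⟨1, ((24 * k + 11 : ℤ) : ℚ), 0, ((-(18 * k + 9) : ℤ) : ℚ), 0⟩ : WeierstrassCurve ℚ)
      (⟨1, ((-12 * k - 7 : ℤ) : ℚ), 0, (((6 * k + 3) ^ 2 : ℤ) : ℚ), 0⟩ : WeierstrassCurve ℚ) := by
  haveI := twoTorsionNF_neighbourB_isElliptic k
  exact ((isIsogenous_of_smul_eq' (smul_twoTorsionNF_eq_neighbourB k)).trans'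
    (isIsogenous_of_eq_twoIsogenyCodomain _ (twoIsogenyCodomain_twoTorsionNF_neighbourB k))).trans'
    (isIsogenous_of_smul_eq (smul_twoIsogenyCodomain_eq_partnerB k))

end NeighbourTypeBModel

end Summit.BirchSwinnertonDyer.Rank2

end
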